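/-
Copyright (c) 2026 the pub-hodgecm-mathlib formalisation cell (harness21).  Prover seat hodgecm-mathlib-K2E3-p17 (g8), Track B «K2-LIT» ∕ h413
(`stmt-HodgeConjecture-24833`), line `K2_E3_EllipticInputs`, leaf (nsc-S-A′), D94 sub-brick S3′ (Q′-side unipotent kit) for C1′ (`hC1low` of ★ ASM p859901).  2026-09-04.
-/
import Summits.HodgeConjecture.HodgeConjecture.Theorems.K2E3GL3UnipotentCharacters        -- ★ (this seat): the `Q = P₂₁` side, `entries_of_mem_upperUnitriangular`, `superdiag_apply_mul`
import HarnessLib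

/-!
# Crux `H413` — leaf (nsc-S-A′), sub-brick S3′ part 1: the `Q′ = P₁₂` side of `U₃ = U_{Q′} · U_{α₂}`

Cell `hodgecm-mathlib`, Track B; THEOREMS ONLY; count-neutral helper (`--supports stmt-HodgeConjecture-24833 --as helper`).  The mirror of ★ `K2E3GL3UnipotentCharacters` §1∕§3
(which treats `U_Q = unipotentRadicalGL F ![false,false,true]` and the root group `U_{α₁} = U₃ ⊓ L_{(2,1)}`): here `U_{Q′} = unipotentRadicalGL F ![false,true,true]` (entries
`(0,1), (0,2)` free, `(1,2) = 0`) and the root group `U_{α₂} = U₃ ⊓ L_{(1,2)} = {x₁₂(t)}` (`standardLeviGL F ![false,true,true]`):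
`mem_unipotentRadical12_iff`, `entries_of_mem_rootGroup12`, `coe_eq_of_mem_rootGroup12`, `transvectionGL12_mem_rootGroup`, `exists_mul_eq_of_mem_upperUnitriangular12`,
**`unipotentRadical12_sup_rootGroup_eq`** (`U_{Q′} ⊔ U_{α₂} = U₃`).  Used by S3′ `K2E3GL3DegenerateStagesCriterionPrime` (θ′-degeneracy ↔ `J_ψ` of the `GL₂`-part of `r_{Q′}`).

HONEST LABEL: HC_CM is proved only modulo the 7 printed citations (2 remaining named inputs: hLiu418 = stmt-HodgeConjecture-24832, h413 =
stmt-HodgeConjecture-24833) until rung 0 closes; count-neutral helper.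

## References
* [BernsteinZelevinskyASENS1977] I. N. Bernstein, A. V. Zelevinsky, *Induced representations of reductive p-adic groups I*, Ann. Sci. ÉNS 10 (1977), §2.1, §3.2.
-/

set_option autoImplicit false
-- the mandated namespace repeats `HodgeConjecture.HodgeConjecture`, as in every `Theorems/*.lean` of this sub-problem
set_option linter.dupNamespace false

noncomputable section

open Matrix Literature.NumberTheory.Automorphic
open scoped MatrixGroups
open Summit.HodgeConjecture.HodgeConjecture.Cruxes.H413.K2E3GL3UnipotentCharacters (entries_of_mem_upperUnitriangular mem_upperUnitriangular_of_entries superdiag_apply_mul)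

namespace Summit.HodgeConjecture.HodgeConjecture.Cruxes.H413.K2E3GL3UnipotentCharactersPrime

variable {F : Type*} [Field F]

/-- `U_{Q′} ≤ U₃`. [cite: BernsteinZelevinskyASENS1977, §2.1] -/
theorem unipotentRadical12_le : unipotentRadicalGL F ![false, true, true] ≤ upperUnitriangular (Fin 3) F :=
  unipotentRadicalGL_le_upperUnitriangular _ (by decide)

/-- **`U_{Q′} = {u ∈ U₃ | u₁₂ = 0}`** (type `(1,2)`: the entry `(1,2)` lies inside the second diagonal block). [cite: BernsteinZelevinskyASENS1977, §2.1] -/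
theorem mem_unipotentRadical12_iff (g : GL (Fin 3) F) :
    g ∈ unipotentRadicalGL F ![false, true, true] ↔ g ∈ upperUnitriangular (Fin 3) F ∧ (g : Matrix (Fin 3) (Fin 3) F) 1 2 = 0 := by
  constructor
  · intro hg
    refine ⟨unipotentRadical12_le hg, ?_⟩
    rw [mem_unipotentRadicalGL_iff_apply] at hg
    rw [hg 1 2 (by decide), Matrix.one_apply_ne (by decide)]
  · rintro ⟨hU, h12⟩
    obtain ⟨h00, h11, h22, h10, h20, h21⟩ := entries_of_mem_upperUnitriangular hU
    rw [mem_unipotentRadicalGL_iff_apply]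
    intro i j hij
    fin_cases i <;> fin_cases j
    · simpa using h00
    · exact absurd hij (by decide)
    · exact absurd hij (by decide)
    · simpa using h10
    · simpa using h11
    · simpa using h12
    · simpa using h20
    · simpa using h21
    · simpa using h22

/-- Entries of a root-group element `h ∈ U₃ ⊓ L_{(1,2)}`: `h₀₁ = h₀₂ = 0`. [cite: BernsteinZelevinskyASENS1977, §2.1] -/
theorem entries_of_mem_rootGroup12 {h : GL (Fin 3) F} (hh : h ∈ unipotentRadicalGL F (id : Fin 3 → Fin 3) ⊓ standardLeviGL F ![false, true, true]) :
    (h : Matrix (Fin 3) (Fin 3) F) 0 1 = 0 ∧ (h : Matrix (Fin 3) (Fin 3) F) 0 2 = 0 := by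
  have hM := (mem_standardLeviGL_iff _ h).1 hh.2
  exact ⟨hM 0 1 (by decide), hM 0 2 (by decide)⟩

/-- **The root group `U_{α₂}` consists of the `x₁₂(t) = 1 + t E₁₂`**, `t = h₁₂`. [cite: BernsteinZelevinskyASENS1977, §2.1] -/
theorem coe_eq_of_mem_rootGroup12 {h : GL (Fin 3) F} (hh : h ∈ unipotentRadicalGL F (id : Fin 3 → Fin 3) ⊓ standardLeviGL F ![false, true, true]) :
    ((h : GL (Fin 3) F) : Matrix (Fin 3) (Fin 3) F) = 1 + Matrix.single 1 2 ((h : Matrix (Fin 3) (Fin 3) F) 1 2) := by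
  obtain ⟨h00, h11, h22, h10, h20, h21⟩ := entries_of_mem_upperUnitriangular (show h ∈ upperUnitriangular (Fin 3) F from hh.1)
  obtain ⟨h01, h02⟩ := entries_of_mem_rootGroup12 hh
  ext i j
  rw [Matrix.add_apply, Matrix.single_apply]
  fin_cases i <;> fin_cases j <;> simp [h00, h11, h22, h10, h20, h21, h01, h02]

/-- `x₁₂(t) ∈ U_{α₂} = U₃ ⊓ L_{(1,2)}`. [cite: BernsteinZelevinskyASENS1977, §2.1] -/
theorem transvectionGL12_mem_rootGroup (t : F) :
    transvectionGL (1 : Fin 3) 2 (by decide) t ∈ unipotentRadicalGL F (id : Fin 3 → Fin 3) ⊓ standardLeviGL F ![false, true, true] :=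
  ⟨mem_unipotentRadicalGL_id_of_eq_transvection (by decide) t _ (coe_transvectionGL _ _ _ _),
    mem_standardLeviGL_of_eq_transvection _ (by decide) t _ (coe_transvectionGL _ _ _ _)⟩

/-- The `(1,2)` entry of `x₁₂(t)` is `t`. [folklore] -/
theorem transvectionGL12_apply_one_two (t : F) : ((transvectionGL (1 : Fin 3) 2 (by decide) t : GL (Fin 3) F) : Matrix (Fin 3) (Fin 3) F) 1 2 = t := by
  rw [coe_transvectionGL, Matrix.transvection, Matrix.add_apply, Matrix.one_apply_ne (by decide), Matrix.single_apply_same, zero_add]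

/-- **`U₃ = U_{Q′} · U_{α₂}`**: every `u ∈ U₃` is `n · h` with `n = u · x₁₂(−u₁₂) ∈ U_{Q′}` and `h = x₁₂(u₁₂) ∈ U_{α₂}`. [cite: BernsteinZelevinskyASENS1977, §2.1] -/
theorem exists_mul_eq_of_mem_upperUnitriangular12 {u : GL (Fin 3) F} (hu : u ∈ upperUnitriangular (Fin 3) F) :
    ∃ n ∈ unipotentRadicalGL F ![false, true, true], ∃ h ∈ unipotentRadicalGL F (id : Fin 3 → Fin 3) ⊓ standardLeviGL F ![false, true, true], u = n * h := by
  set x : F := (u : Matrix (Fin 3) (Fin 3) F) 1 2 with hx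
  refine ⟨u * transvectionGL (1 : Fin 3) 2 (by decide) (-x), ?_, transvectionGL (1 : Fin 3) 2 (by decide) x, transvectionGL12_mem_rootGroup x, ?_⟩
  · rw [mem_unipotentRadical12_iff]
    refine ⟨Subgroup.mul_mem _ hu (transvectionGL12_mem_rootGroup (-x)).1, ?_⟩
    rw [(superdiag_apply_mul hu (transvectionGL12_mem_rootGroup (-x)).1).2, transvectionGL12_apply_one_two, ← hx, add_neg_cancel]
  · rw [transvectionGL_neg, inv_mul_cancel_right]

/-- **`U_{Q′} ⊔ U_{α₂} = U₃`.** [cite: BernsteinZelevinskyASENS1977, §2.1] -/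
theorem unipotentRadical12_sup_rootGroup_eq :
    unipotentRadicalGL F ![false, true, true] ⊔ (unipotentRadicalGL F (id : Fin 3 → Fin 3) ⊓ standardLeviGL F ![false, true, true]) = upperUnitriangular (Fin 3) F := by
  refine le_antisymm (sup_le unipotentRadical12_le fun g hg => hg.1) fun u hu => ?_
  obtain ⟨n, hn, h, hh, rfl⟩ := exists_mul_eq_of_mem_upperUnitriangular12 hu
  exact Subgroup.mul_mem _ (Subgroup.mem_sup_left hn) (Subgroup.mem_sup_right hh)

end Summit.HodgeConjecture.HodgeConjecture.Cruxes.H413.K2E3GL3UnipotentCharactersPrime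

end
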